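import Summits.Ventures.WeilGRH.DualTrigCertMod13OddLog5HalfA
import HarnessLib

/-!
# Format D-K instance (part B: remaining cell ranges, assembly, rung): Weil positivity for L(s, χ), χ mod 13 odd with χ(2) = −i, χ(3) = 1, on [−(log 5)/2, (log 5)/2]

Cell `rh-explicit`, WEIL TRACK — GRH ARM, route B (weil-grh-3).  A kernel-checked format-D-K certificate
(`DualTrigKernelDefs/Check.lean`, soundness `DualTrigKernelSound.lean`) for the class `13.5` of the
arm's census: modulus q = 13, parity a = 1, window `N = 4` (t = log 5 / 2 ≈ 0.8047),
window values χ(2) = −i, χ(3) = 1; atoms on the grid `k · log 2 / 8`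
(51 atoms, LP margin 0.476); 542 cells covering `|τ| ≤ 98.3`; periodic-tail
bound `mT = -4.0300`.  `DKCert.check` is evaluated by `decide +kernel`; the rung follows from
`DKCert.weilPositivityOnChar_of_check`.  Honest scope: a THEOREM for every Dirichlet character `χ` mod 13
with the listed parity and prime values, for test functions supported in `[−t, t]`; nothing beyond this
window.  No named facts, no `sorry`; axioms standard.
-/

namespace Summit.Ventures.WeilGRH

open Literature.NumberTheory.LFunctions Literature.Analysis.ValidatedNumerics.NumericsMP

set_option maxHeartbeats 0 in
/-- Cells `[271, 542)` of block 0 pass. [folklore] -/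
theorem cert_q13_odd_negi_log5half_cells_b0 : cert_q13_odd_negi_log5half.blockRangeOK (cert_q13_odd_negi_log5half.blocks.getD 0 ⟨1, 0, 0, 1, 1, 1, []⟩) 271 271 = true := by
  decide +kernel

/-- Splitting a cell range of a block: ranges `[i0, i0+m)` and `[i0+m, i0+m+n)` give `[i0, i0+m+n)`. [folklore] -/
theorem cert_q13_odd_negi_log5half_rangeSplit (b : DKBlock) (i0 m n : ℕ) (h1 : cert_q13_odd_negi_log5half.blockRangeOK b i0 m = true)
    (h2 : cert_q13_odd_negi_log5half.blockRangeOK b (i0 + m) n = true) : cert_q13_odd_negi_log5half.blockRangeOK b i0 (m + n) = true := by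
  unfold DKCert.blockRangeOK at *
  simp only [List.all_eq_true, List.mem_range] at *
  intro i hi
  by_cases him : i < m
  · exact h1 i him
  · have h := h2 (i - m) (by omega)
    have e : i0 + m + (i - m) = i0 + i := by omega
    rw [e] at h
    exact h

/-- All cells of all blocks pass (assembled from the parts). [folklore] -/
theorem cert_q13_odd_negi_log5half_cellsOK : cert_q13_odd_negi_log5half.cellsOK = true := by
  have g0x0 : cert_q13_odd_negi_log5half.blockRangeOK (cert_q13_odd_negi_log5half.blocks.getD 0 ⟨1, 0, 0, 1, 1, 1, []⟩) 0 271 = true := cert_q13_odd_negi_log5half_cells_a0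
  have g0x1 : cert_q13_odd_negi_log5half.blockRangeOK (cert_q13_odd_negi_log5half.blocks.getD 0 ⟨1, 0, 0, 1, 1, 1, []⟩) 0 (271 + 271) = true :=
    cert_q13_odd_negi_log5half_rangeSplit _ 0 271 271 g0x0 (by simpa using cert_q13_odd_negi_log5half_cells_b0)
  have hb : cert_q13_odd_negi_log5half.blocks = [(cert_q13_odd_negi_log5half.blocks.getD 0 ⟨1, 0, 0, 1, 1, 1, []⟩)] := rfl
  unfold DKCert.cellsOK
  rw [hb]
  simp only [List.all_cons, List.all_nil, Bool.and_true]
  exact g0x1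

/-- The complete check passes. [folklore] -/
theorem cert_q13_odd_negi_log5half_check : cert_q13_odd_negi_log5half.check = true := by
  rw [DKCert.check, cert_q13_odd_negi_log5half_frameOK, cert_q13_odd_negi_log5half_cellsOK]; rfl

/-- **Weil positivity for L(s, χ), χ mod 13 odd with χ(2) = −i, χ(3) = 1, on [−(log 5)/2, (log 5)/2]**: `Re W_χ(g ⋆ g̃) ≥ 0` for every smooth `g` supported in `[−t, t]`,
`t = log 5 / 2`, for every Dirichlet character `χ` mod 13 with parity 1 and χ(2) = −i, χ(3) = 1.
Kernel-checked format-D-K certificate. [folklore] -/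
theorem weilPositivityOnChar_mod13_odd_chi2_negI_chi3_one_log5half (χ : DirichletCharacter ℂ 13) (hpar : charParity χ = 1) (hχ2 : χ 2 = -Complex.I) (hχ3 : χ 3 = 1) :
    WeilPositivityOnChar χ (Real.log 5 / 2) := by
  have h := DKCert.weilPositivityOnChar_of_check cert_q13_odd_negi_log5half_check (by decide) χ hpar ?_
  · have e : Real.log ((cert_q13_odd_negi_log5half.N : ℝ) + 1) / 2 = Real.log 5 / 2 := by
      rw [show cert_q13_odd_negi_log5half.N = 4 from rfl]; norm_num
    rw [e] at h
    exact h
  · intro val hval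
    simp only [cert_q13_odd_negi_log5half, List.mem_cons, List.mem_nil_iff, or_false] at hval
    rcases hval with rfl | rfl | rfl
    · change χ ((2 : ℕ) : ZMod 13) = _
      rw [Nat.cast_ofNat, hχ2, DKCert.valZ_negQuarter]
    · change χ ((3 : ℕ) : ZMod 13) = _
      rw [Nat.cast_ofNat, hχ3, DKCert.valZ_zero]
    · change χ ((4 : ℕ) : ZMod 13) = _
      have hpow : ((4 : ℕ) : ZMod 13) = (2 : ZMod 13) ^ 2 := by norm_num
      rw [hpow, map_pow, hχ2, DKCert.valZ_half]; simp [pow_two]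

end Summit.Ventures.WeilGRH
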